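import Literature.MathematicalPhysics.QuantumFieldTheory.Balaban1983to89.B9Thm31SiteAgmonWeightY

/-!
# `Balaban1983to89.B9Thm31SiteGpWeightedReg335Y` — T. Bałaban, *Propagators for lattice gauge theories in a background field*, Commun. Math. Phys. **99**
# (1985) 389–434 [Balaban1985BackgroundPropagators] Thm 3.1 (3.47)∕(3.46) pp. 397–398 with (3.41) p. 397, by S. Agmon's positive-weight method [Agmon1982]:
# ★★★ **THE GLOBAL WEIGHTED `L²` ESTIMATE FOR def-Y's `G′(U)` ON THE (3.35) CLASS** — for EVERY admissible weight `ω` (no support conditions):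
# `c₀²·Σ_z (L^{lev z})⁻²·ω_z²·HS((G′(U)Ψ)(z)) ≤ Σ_z (L^{lev z})²·ω_z²·HS(Ψ(z))`, `c₀ ≥ 1∕16` — «`G′` costs two powers of the local scale, uniformly, through any
# Agmon weight»; at `ω ≡ 1` this is the `L²` form of (3.47) at `γ = −1`, and with `ω = e^{δ₀ρ}` it is the exponentially weighted master inequality behind (3.46)
# (file 10 of the site-coercivity set of width seat `pub-ymgap-dag-n06-w1`)

statement-level skeleton of published theorems with citation tags; proofs where landed; nothing here is a claim about the Yang–Mills mass gap

THE PRINT.  (3.41) p. 397: *«|A|_{(α)} = sup_j sup_{b∈Ω_j∖Ω_{j+1}} (Lʲη)^{−α}|A(b)|»* (the scale-weighted norms); (3.47) p. 398: *«and the global inequalities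
|G′(U)λ|_{(2+γ)}, |∇_UG′(U)λ|_{(1+γ)}, |G′(U)∇\*_Uλ|_{(1+γ)}, … ≤ B₀|λ|_{(γ)} for γ in a fixed compact subset of real numbers, e.g. for γ ∈ [−4, 4]»*; p. 398:
*«the global inequalities (3.47) are consequences of the local ones (3.42) and Lemma 2.1»*.  Print's (3.47) is in SUP norms; this file is its `L²` analogue
at `γ = −1` — output weight `(Lʲη)^{−1}`, input weight `(Lʲη)^{+1}` — obtained DIRECTLY (no summation lemma) from the level-weighted coercivity, and its
exponentially weighted generalisation.

WHY THIS FILE ∕ THE ARGUMENT.  With `Φ = G′(U)Ψ` and an admissible weight `ω` (bond ratios `q ≤ θ_b(L^{lev})⁻²`, block oscillation `q ≤ θ_s`,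
`(d+1)θ_b + θ_s∕2 ≤ 1∕16`), file 6's conjugated coercivity at `Φ′ = ωΦ` reads `c₀·M ≤ ⟨ω²Φ, Ψ⟩₁` with `M = Σ_z m_zω_z²HS(Φ z)` (no support condition is
needed for this identity), and the weighted Cauchy–Schwarz `⟨ω²Φ, Ψ⟩₁ ≤ Σ_z (√m_z·ω_z·‖Φ z‖)(ω_z‖Ψ z‖∕√m_z) ≤ √M·√R`, `R = Σ_z m_z⁻¹ω_z²HS(Ψ z)`, gives `c₀²M ≤ R`.

WHAT IS PROVED (sorry-free; 0 `def`; nothing of [B9] asserted beyond what is proved).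
* `conj_wsmul_GpY_eq_wsq_pairing` (`⟨ω(ωΦ), Δ′_a(ω⁻¹(ωΦ))⟩₁ = ⟨ω²Φ, Ψ⟩₁` at `Φ = G′Ψ`), `trIP_wsq_le_sqrt_mul_sqrt` (the weighted Cauchy–Schwarz),
  ★★★ **`levelMass_wsmul_GpY_le`** (`(1∕8 − (d+1)θ_b − θ_s∕2)²·Σ_z m_zω_z²HS((G′Ψ)z) ≤ Σ_z m_z⁻¹ω_z²HS(Ψ z)` for every admissible `ω`), ★★ **`levelMass_GpY_le`**
  (`ω ≡ 1`: `Σ_z (L^{lev z})⁻²HS((G′Ψ)z) ≤ 64·Σ_z (L^{lev z})²HS(Ψ z)` — (3.47)'s `γ = −1` in `L²`), ★★★ **`levelMass_exp_GpY_le_canonical`** (`ω = e^{δ₀ρ}`,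
  `δ₀ = 1∕(4(d+2))`, `ρ` bond-Lipschitz at scale `(L^{lev})⁻¹` with block oscillation `≤ d+1`: `Σ_z m_z e^{2δ₀ρ_z}HS((G′Ψ)z) ≤ 256·Σ_z m_z⁻¹e^{2δ₀ρ_z}HS(Ψ z)`);
  ★★★ **`hs_GpY_deltaY_le_exp_canonical`** (THE KERNEL: `HS((G′(U)(δ_y ⊗ E))(x)) ≤ 256·(L^{lev x})²(L^{lev y})²·e^{−2δ₀r}·HS(E)` for `ρ(y) = 0`, `ρ(x) ≥ r` —
  print's (3.42)₁ shape `B₀(Lʲη)²e^{−δ₀d}` for one-site sources).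
MODEL ∕ DECLARED READINGS.  As files 6–7.  NON-VACUITY (A6): `ω ≡ 1` and every `e^{δ₀ρ}` with an admissible `ρ` (e.g. `ρ ≡ 0`); the class is inhabited.
NOT HERE: the sup-norm (3.47), other `γ`, the derivative entries, the bond sector.  HONEST SCOPE.  A weighted `L²` estimate for one finite lattice operator at a
time; NOT a node discharge, NOT summit progress; count-neutral; nothing continuum ∕ OS ∕ mass gap ∕ Clay.  NEW file importing file 7 only.  Net new unproved facts: 0.
-/

noncomputable section

namespace Literature.MathematicalPhysics.QuantumFieldTheory.Balaban1983to89.B9Thm31SiteGpWeightedReg335Y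

open Literature.MathematicalPhysics.QuantumFieldTheory.Balaban1983to89
open Node00 B6KLevelCensusIndexV1 B6Geom246MultiLevelBox B6MultiLevelBoxOperator B6MultiLevelTorusOperator B6GlobalChartV1 B9BackgroundsKLevelV1
  B9Eq39Adjoint B9Thm311ReadingCoords B9Thm311DeltaPrimePos B9Ineq369CurvatureSmallAtLettersY B9Thm31SiteCoerciveGaugeBlockY
  B9Thm31SiteCoerciveReg335Y B9Thm31SiteGpBoundsReg335Y B9Thm31SitePolarisedFormY B9Thm31SiteConjugatedFormY B9Thm31SiteGpDecayReg335Y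
  B9Thm31SiteAgmonWeightY
open Literature.MathematicalPhysics.QuantumFieldTheory.Balaban1983to89.B9Thm311DeltaPrimeSymm (trIP_one_eq)
open Literature.MathematicalPhysics.QuantumFieldTheory.Balaban1983to89.B9Thm311FlippedBondLetters (hs_real_smul)
open Literature.MathematicalPhysics.QuantumFieldTheory.Balaban1983to89.B9Ineq349SiteAdjoint (trIP_deltaY_left)
open scoped Matrix Matrix.Norms.L2Operator

variable {d ℓ : ℕ} {hd : 1 ≤ d + 1} {hL : Odd (ℓ + 1) ∧ 1 < ℓ + 1} {b₀ b₁ : ℝ}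
variable (i : KIdx d ℓ hd hL b₀ b₁) {N : ℕ} {G : Subgroup (Matrix (Fin N) (Fin N) ℂ)ˣ}

/-- at `Φ = G′(U)Ψ` the conjugated form of `ωΦ` is the `ω²`-weighted pairing with the source: `⟨ω(ωΦ), Δ′_a(U)(ω⁻¹(ωΦ))⟩₁ = ⟨ω²Φ, Ψ⟩₁` (no support condition;
`G`-valued `U`, `G ≤ U(N)`). [cite: Agmon1982, Ch.1; Balaban1985BackgroundPropagators, (3.25) p.394] -/
theorem conj_wsmul_GpY_eq_wsq_pairing (hG : G ≤ B7Prop2Explicit.unitaryUnits (Matrix (Fin N) (Fin N) ℂ)) {U : CfgY (Matrix (Fin N) (Fin N) ℂ) i}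
    (hU : ∀ μ x, U μ x ∈ G) {ω : SiteY i → ℝ} (hω : ∀ z, 0 < ω z) (Ψ : SiteY i → Matrix (Fin N) (Fin N) ℂ) :
    trIP (fun _ => (1 : ℝ)) (fun z => ((ω z : ℝ) : ℂ) • (((ω z : ℝ) : ℂ) • GpY i (parSymY i) U Ψ z))
        (deltaPrimeAY i (parSymY i) U (fun z => (((ω z)⁻¹ : ℝ) : ℂ) • (((ω z : ℝ) : ℂ) • GpY i (parSymY i) U Ψ z)))
      = trIP (fun _ => (1 : ℝ)) (fun z => ((ω z : ℝ) : ℂ) • (((ω z : ℝ) : ℂ) • GpY i (parSymY i) U Ψ z)) Ψ := by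
  have hunit : IsUnit (deltaPrimeAY i (parSymY i) U) := isUnit_deltaPrimeAY_parSymY i hG hU
  have hinvΦ : (fun z => (((ω z)⁻¹ : ℝ) : ℂ) • (((ω z : ℝ) : ℂ) • GpY i (parSymY i) U Ψ z)) = GpY i (parSymY i) U Ψ := by
    funext z
    rw [smul_smul, ← Complex.ofReal_mul, inv_mul_cancel₀ (hω z).ne', Complex.ofReal_one, one_smul]
  have hΔΦ : deltaPrimeAY i (parSymY i) U (GpY i (parSymY i) U Ψ) = Ψ := apply_inverse_of_isUnit hunit Ψ
  rw [hinvΦ, hΔΦ]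

/-- THE WEIGHTED CAUCHY–SCHWARZ OVER SITES: for `m > 0`, `⟨ω²Φ, Ψ⟩₁ ≤ √(Σ_z m_z·HS(ω_zΦ z))·√(Σ_z m_z⁻¹·HS(ω_zΨ z))`.
[cite: Balaban1985BackgroundPropagators, p.393 (scalar products); Agmon1982, Ch.1, bookkeeping] -/
theorem trIP_wsq_le_sqrt_mul_sqrt {S : Type} [Fintype S] {m : S → ℝ} (hm : ∀ z, 0 < m z) (ω : S → ℝ) (Φ Ψ : S → Matrix (Fin N) (Fin N) ℂ) :
    trIP (fun _ => (1 : ℝ)) (fun z => ((ω z : ℝ) : ℂ) • (((ω z : ℝ) : ℂ) • Φ z)) Ψ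
      ≤ Real.sqrt (∑ z, m z * ∑ a, ∑ b, ‖(((ω z : ℝ) : ℂ) • Φ z) a b‖ ^ 2) * Real.sqrt (∑ z, (m z)⁻¹ * ∑ a, ∑ b, ‖(((ω z : ℝ) : ℂ) • Ψ z) a b‖ ^ 2) := by
  rw [trIP_one_eq, Complex.re_sum]
  -- per site: `Re tr((ω²Φ z)ᴴΨ z) = Re tr((ωΦ z)ᴴ(ωΨ z)) ≤ √HS(ωΦ z)·√HS(ωΨ z) = (√m·√HS(ωΦ))·(√HS(ωΨ)∕√m)`
  have hz : ∀ z, (Matrix.trace ((((ω z : ℝ) : ℂ) • (((ω z : ℝ) : ℂ) • Φ z))ᴴ * Ψ z)).re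
      ≤ Real.sqrt (m z * ∑ a, ∑ b, ‖(((ω z : ℝ) : ℂ) • Φ z) a b‖ ^ 2) * Real.sqrt ((m z)⁻¹ * ∑ a, ∑ b, ‖(((ω z : ℝ) : ℂ) • Ψ z) a b‖ ^ 2) := by
    intro z
    have e : (Matrix.trace ((((ω z : ℝ) : ℂ) • (((ω z : ℝ) : ℂ) • Φ z))ᴴ * Ψ z)).re
        = (Matrix.trace ((((ω z : ℝ) : ℂ) • Φ z)ᴴ * (((ω z : ℝ) : ℂ) • Ψ z))).re := by
      rw [re_trace_ofReal_smul_left, re_trace_ofReal_smul_left, re_trace_ofReal_smul_right, re_trace_ofReal_smul_left]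
    rw [e]
    refine (le_abs_self _).trans ((abs_re_trace_le _ _).trans (le_of_eq ?_))
    rw [Real.sqrt_mul (hm z).le, Real.sqrt_mul (inv_nonneg.2 (hm z).le), Real.sqrt_inv]
    have hs : Real.sqrt (m z) ≠ 0 := (Real.sqrt_pos.2 (hm z)).ne'
    field_simp
  refine (Finset.sum_le_sum fun z _ => hz z).trans ?_
  -- discrete Cauchy–Schwarz `Σ a_z b_z ≤ √(Σ a_z²)·√(Σ b_z²)` with `a_z² = m HS(ωΦ)`, `b_z² = m⁻¹ HS(ωΨ)`
  have hcs := Real.sum_mul_le_sqrt_mul_sqrt Finset.univ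
    (fun z => Real.sqrt (m z * ∑ a, ∑ b, ‖(((ω z : ℝ) : ℂ) • Φ z) a b‖ ^ 2))
    (fun z => Real.sqrt ((m z)⁻¹ * ∑ a, ∑ b, ‖(((ω z : ℝ) : ℂ) • Ψ z) a b‖ ^ 2))
  refine hcs.trans (le_of_eq ?_)
  congr 1
  · congr 1
    exact Finset.sum_congr rfl fun z _ => Real.sq_sqrt (mul_nonneg (hm z).le (hs_nonneg _))
  · congr 1
    exact Finset.sum_congr rfl fun z _ => Real.sq_sqrt (mul_nonneg (inv_nonneg.2 (hm z).le) (hs_nonneg _))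

/-- ★★★ **THE GLOBAL WEIGHTED `L²` ESTIMATE FOR `G′(U)` ON THE CLASS (3.35)**: `G ≤ U(N)`, `N ≥ 1`, `0 ≤ c·M·α₀`, `c·M·α₀·(d+1) ≤ 1∕16`, `U ∈ Reg335 c α₀`;
a weight `ω > 0` with bond ratios `q(ω(z+e_μ), ω z) ≤ θ_b·(L^{lev})⁻²` (both ends) and block oscillation `q ≤ θ_s`, `c₀ := 1∕8 − ((d+1)θ_b + θ_s∕2) > 0`.  THEN
`c₀²·Σ_z (L^{lev z})⁻²·HS(ω_z·(G′(U)Ψ)(z)) ≤ Σ_z (L^{lev z})²·HS(ω_z·Ψ(z))` for EVERY `Ψ` (no support conditions).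
[cite: Balaban1985BackgroundPropagators, Thm 3.1 (3.47) p.398, (3.41) p.397; Agmon1982, Ch.1, Thm 1.5] -/
theorem levelMass_wsmul_GpY_le [Nonempty (Fin N)] (hG : G ≤ B7Prop2Explicit.unitaryUnits (Matrix (Fin N) (Fin N) ℂ))
    {U : CfgY (Matrix (Fin N) (Fin N) ℂ) i} {c α₀ : ℝ} (hC0 : 0 ≤ c * (kGeo i).M * α₀) (hC1 : c * (kGeo i).M * α₀ * ((d : ℝ) + 1) ≤ 1 / 16)
    (hreg : (bg9K (Matrix (Fin N) (Fin N) ℂ) G i).Reg335 c α₀ U) {ω : SiteY i → ℝ} (hω : ∀ z, 0 < ω z) {θb θs : ℝ}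
    (hb1 : ∀ μ z, ω (shiftY i μ z) / ω z + ω z / ω (shiftY i μ z) - 2 ≤ θb * (((((ℓ + 1) ^ (blkOf i.D.toDomains z).1.1 : ℕ) : ℝ)) ^ 2)⁻¹)
    (hb2 : ∀ μ z, ω (shiftY i μ z) / ω z + ω z / ω (shiftY i μ z) - 2 ≤ θb * (((((ℓ + 1) ^ (blkOf i.D.toDomains (shiftY i μ z)).1.1 : ℕ) : ℝ)) ^ 2)⁻¹)
    (hs : ∀ z w : SiteY i, blkOf i.D.toDomains w = blkOf i.D.toDomains z → ω z / ω w + ω w / ω z - 2 ≤ θs)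
    (hc₀ : 0 < 1 / 8 - (((d : ℝ) + 1) * θb + θs / 2)) (Ψ : SiteY i → Matrix (Fin N) (Fin N) ℂ) :
    (1 / 8 - (((d : ℝ) + 1) * θb + θs / 2)) ^ 2 *
        ∑ z : SiteY i, (((((ℓ + 1) ^ (blkOf i.D.toDomains z).1.1 : ℕ) : ℝ)) ^ 2)⁻¹ * ∑ a, ∑ b, ‖(((ω z : ℝ) : ℂ) • GpY i (parSymY i) U Ψ z) a b‖ ^ 2
      ≤ ∑ z : SiteY i, ((((ℓ + 1) ^ (blkOf i.D.toDomains z).1.1 : ℕ) : ℝ)) ^ 2 * ∑ a, ∑ b, ‖(((ω z : ℝ) : ℂ) • Ψ z) a b‖ ^ 2 := by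
  have hU : ∀ μ x, U μ x ∈ G := hreg.1
  have hm : ∀ z : SiteY i, (0 : ℝ) < (((((ℓ + 1) ^ (blkOf i.D.toDomains z).1.1 : ℕ) : ℝ)) ^ 2)⁻¹ := fun z => inv_pos.2 (by positivity)
  -- `c₀ M ≤ X`
  have hconj := trIP_wsmul_deltaPrimeAY_winv_ge_levelMass i hG hC0 hC1 hreg hω hb1 hb2 hs (fun z => ((ω z : ℝ) : ℂ) • GpY i (parSymY i) U Ψ z)
  rw [conj_wsmul_GpY_eq_wsq_pairing i hG hU hω Ψ] at hconj
  -- `X ≤ √M √R`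
  have hcs := trIP_wsq_le_sqrt_mul_sqrt (N := N) hm ω (GpY i (parSymY i) U Ψ) Ψ
  have hR : ∑ z : SiteY i, ((((((ℓ + 1) ^ (blkOf i.D.toDomains z).1.1 : ℕ) : ℝ)) ^ 2)⁻¹)⁻¹ * ∑ a, ∑ b, ‖(((ω z : ℝ) : ℂ) • Ψ z) a b‖ ^ 2
      = ∑ z : SiteY i, ((((ℓ + 1) ^ (blkOf i.D.toDomains z).1.1 : ℕ) : ℝ)) ^ 2 * ∑ a, ∑ b, ‖(((ω z : ℝ) : ℂ) • Ψ z) a b‖ ^ 2 :=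
    Finset.sum_congr rfl fun z _ => by rw [inv_inv]
  rw [hR] at hcs
  set M := ∑ z : SiteY i, (((((ℓ + 1) ^ (blkOf i.D.toDomains z).1.1 : ℕ) : ℝ)) ^ 2)⁻¹ * ∑ a, ∑ b, ‖(((ω z : ℝ) : ℂ) • GpY i (parSymY i) U Ψ z) a b‖ ^ 2
    with hM
  set R := ∑ z : SiteY i, ((((ℓ + 1) ^ (blkOf i.D.toDomains z).1.1 : ℕ) : ℝ)) ^ 2 * ∑ a, ∑ b, ‖(((ω z : ℝ) : ℂ) • Ψ z) a b‖ ^ 2 with hRdef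
  set c₀ := 1 / 8 - (((d : ℝ) + 1) * θb + θs / 2) with hc₀def
  have hM0 : 0 ≤ M := Finset.sum_nonneg fun z _ => mul_nonneg (hm z).le (hs_nonneg _)
  have hR0 : 0 ≤ R := Finset.sum_nonneg fun z _ => mul_nonneg (by positivity) (hs_nonneg _)
  have h1 : c₀ * M ≤ Real.sqrt M * Real.sqrt R := hconj.trans hcs
  -- `(c₀M)² ≤ M·R ⇒ c₀²M ≤ R`
  have h2 : (c₀ * M) ^ 2 ≤ M * R := by
    calc (c₀ * M) ^ 2 ≤ (Real.sqrt M * Real.sqrt R) ^ 2 := pow_le_pow_left₀ (mul_nonneg hc₀.le hM0) h1 2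
      _ = M * R := by rw [mul_pow, Real.sq_sqrt hM0, Real.sq_sqrt hR0]
  rcases hM0.eq_or_lt with h0 | hpos
  · rw [← h0, mul_zero]; exact hR0
  · have h3 : c₀ ^ 2 * M * M ≤ R * M := by nlinarith
    exact le_of_mul_le_mul_right h3 hpos

/-- ★★ **(3.47) AT `γ = −1` IN `L²` FORM** (`ω ≡ 1`): on the class, `Σ_z (L^{lev z})⁻²·HS((G′(U)Ψ)(z)) ≤ 64·Σ_z (L^{lev z})²·HS(Ψ(z))` — `G′` costs two powers of the
local scale, member-∕volume-∕k-∕N-∕U-uniformly. [cite: Balaban1985BackgroundPropagators, Thm 3.1 (3.47) p.398, (3.41) p.397] -/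
theorem levelMass_GpY_le [Nonempty (Fin N)] (hG : G ≤ B7Prop2Explicit.unitaryUnits (Matrix (Fin N) (Fin N) ℂ))
    {U : CfgY (Matrix (Fin N) (Fin N) ℂ) i} {c α₀ : ℝ} (hC0 : 0 ≤ c * (kGeo i).M * α₀) (hC1 : c * (kGeo i).M * α₀ * ((d : ℝ) + 1) ≤ 1 / 16)
    (hreg : (bg9K (Matrix (Fin N) (Fin N) ℂ) G i).Reg335 c α₀ U) (Ψ : SiteY i → Matrix (Fin N) (Fin N) ℂ) :
    ∑ z : SiteY i, (((((ℓ + 1) ^ (blkOf i.D.toDomains z).1.1 : ℕ) : ℝ)) ^ 2)⁻¹ * ∑ a, ∑ b, ‖GpY i (parSymY i) U Ψ z a b‖ ^ 2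
      ≤ 64 * ∑ z : SiteY i, ((((ℓ + 1) ^ (blkOf i.D.toDomains z).1.1 : ℕ) : ℝ)) ^ 2 * ∑ a, ∑ b, ‖Ψ z a b‖ ^ 2 := by
  have hq : ∀ z w : SiteY i, (1 : ℝ) / 1 + 1 / 1 - 2 = 0 := fun _ _ => by norm_num
  have h := levelMass_wsmul_GpY_le i hG hC0 hC1 hreg (ω := fun _ => (1 : ℝ)) (fun _ => one_pos) (θb := 0) (θs := 0)
    (fun μ z => by rw [hq z z, zero_mul]) (fun μ z => by rw [hq z z, zero_mul]) (fun z w _ => by rw [hq z w]) (by norm_num) Ψ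
  simp only [Complex.ofReal_one, one_smul] at h
  have e : (1 / 8 - (((d : ℝ) + 1) * 0 + 0 / 2)) ^ 2 = 1 / 64 := by norm_num
  rw [e] at h
  linarith

/-- ★★★ **THE EXPONENTIALLY WEIGHTED MASTER INEQUALITY** (`ω = e^{δ₀ρ}`, `δ₀ = 1∕(4(d+2))`; `ρ` with `|ρ(z+e_μ) − ρ z| ≤ (L^{lev})⁻¹` at both ends of every bond and
`|ρ z − ρ w| ≤ d+1` on every block of `𝔅`): on the class, for every `Ψ`,
`Σ_z (L^{lev z})⁻²·e^{2δ₀ρ_z}·HS((G′(U)Ψ)(z)) ≤ 256·Σ_z (L^{lev z})²·e^{2δ₀ρ_z}·HS(Ψ(z))`. [cite: Balaban1985BackgroundPropagators, Thm 3.1 (3.46)–(3.47) p.398; Agmon1982, Ch.1, Thm 1.5] -/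
theorem levelMass_exp_GpY_le_canonical [Nonempty (Fin N)] (hG : G ≤ B7Prop2Explicit.unitaryUnits (Matrix (Fin N) (Fin N) ℂ))
    {U : CfgY (Matrix (Fin N) (Fin N) ℂ) i} {c α₀ : ℝ} (hC0 : 0 ≤ c * (kGeo i).M * α₀) (hC1 : c * (kGeo i).M * α₀ * ((d : ℝ) + 1) ≤ 1 / 16)
    (hreg : (bg9K (Matrix (Fin N) (Fin N) ℂ) G i).Reg335 c α₀ U) {ρ : SiteY i → ℝ}
    (hρ1 : ∀ μ z, |ρ (shiftY i μ z) - ρ z| ≤ ((((ℓ + 1) ^ (blkOf i.D.toDomains z).1.1 : ℕ) : ℝ))⁻¹)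
    (hρ2 : ∀ μ z, |ρ (shiftY i μ z) - ρ z| ≤ ((((ℓ + 1) ^ (blkOf i.D.toDomains (shiftY i μ z)).1.1 : ℕ) : ℝ))⁻¹)
    (hρD : ∀ z w : SiteY i, blkOf i.D.toDomains w = blkOf i.D.toDomains z → |ρ z - ρ w| ≤ (d : ℝ) + 1) (Ψ : SiteY i → Matrix (Fin N) (Fin N) ℂ) :
    ∑ z : SiteY i, (((((ℓ + 1) ^ (blkOf i.D.toDomains z).1.1 : ℕ) : ℝ)) ^ 2)⁻¹ *
          (Real.exp ((1 / (4 * ((d : ℝ) + 2))) * ρ z) ^ 2 * ∑ a, ∑ b, ‖GpY i (parSymY i) U Ψ z a b‖ ^ 2)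
      ≤ 256 * ∑ z : SiteY i, ((((ℓ + 1) ^ (blkOf i.D.toDomains z).1.1 : ℕ) : ℝ)) ^ 2 *
          (Real.exp ((1 / (4 * ((d : ℝ) + 2))) * ρ z) ^ 2 * ∑ a, ∑ b, ‖Ψ z a b‖ ^ 2) := by
  have hd0 : (0 : ℝ) ≤ d := Nat.cast_nonneg d
  have hd2 : (0 : ℝ) < 4 * ((d : ℝ) + 2) := by positivity
  have hδ0 : (0 : ℝ) ≤ 1 / (4 * ((d : ℝ) + 2)) := by positivity
  have hδ1 : 1 / (4 * ((d : ℝ) + 2)) ≤ 1 := by rw [div_le_one hd2]; linarith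
  have hδD : 1 / (4 * ((d : ℝ) + 2)) * ((d : ℝ) + 1) ≤ 1 := by
    rw [div_mul_eq_mul_div, one_mul, div_le_one hd2]; linarith
  have hδκ0 : (1 / (4 * ((d : ℝ) + 2))) ^ 2 * (2 * ((d : ℝ) + 1) + ((d : ℝ) + 1) ^ 2) ≤ 1 / 16 := by
    rw [div_pow, one_pow, mul_pow, one_div_mul_eq_div, div_le_iff₀ (by positivity)]
    nlinarith
  have hc₀ : 1 / 16 ≤ 1 / 8 - (((d : ℝ) + 1) * (2 * (1 / (4 * ((d : ℝ) + 2))) ^ 2) + (2 * (1 / (4 * ((d : ℝ) + 2))) ^ 2 * ((d : ℝ) + 1) ^ 2) / 2) := by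
    have e : ((d : ℝ) + 1) * (2 * (1 / (4 * ((d : ℝ) + 2))) ^ 2) + (2 * (1 / (4 * ((d : ℝ) + 2))) ^ 2 * ((d : ℝ) + 1) ^ 2) / 2
        = (1 / (4 * ((d : ℝ) + 2))) ^ 2 * (2 * ((d : ℝ) + 1) + ((d : ℝ) + 1) ^ 2) := by ring
    rw [e]; linarith
  have hω : ∀ z, 0 < Real.exp (1 / (4 * ((d : ℝ) + 2)) * ρ z) := fun z => Real.exp_pos _
  have h := levelMass_wsmul_GpY_le i hG hC0 hC1 hreg hω (fun μ z => bondRatio_exp_le i hδ0 hδ1 μ z (hρ1 μ z))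
    (fun μ z => bondRatio_exp_le' i hδ0 hδ1 μ z (hρ2 μ z)) (fun z w hzw => blockOsc_exp_le i hδ0 hδD z w (hρD z w hzw)) (lt_of_lt_of_le (by norm_num) hc₀) Ψ
  simp only [hs_real_smul] at h
  -- `c₀² ≥ 1∕256`
  set c₀ := 1 / 8 - (((d : ℝ) + 1) * (2 * (1 / (4 * ((d : ℝ) + 2))) ^ 2) + (2 * (1 / (4 * ((d : ℝ) + 2))) ^ 2 * ((d : ℝ) + 1) ^ 2) / 2) with hc₀def
  have hc2 : (1 / 256 : ℝ) ≤ c₀ ^ 2 := by nlinarith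
  have hM0 : 0 ≤ ∑ z : SiteY i, (((((ℓ + 1) ^ (blkOf i.D.toDomains z).1.1 : ℕ) : ℝ)) ^ 2)⁻¹ *
      (Real.exp ((1 / (4 * ((d : ℝ) + 2))) * ρ z) ^ 2 * ∑ a, ∑ b, ‖GpY i (parSymY i) U Ψ z a b‖ ^ 2) :=
    Finset.sum_nonneg fun z _ => mul_nonneg (inv_nonneg.2 (by positivity)) (mul_nonneg (sq_nonneg _) (hs_nonneg _))
  nlinarith

/-! ## The kernel of `G′(U)` decays exponentially in any Agmon weight -/

/-- ★★★ **THE KERNEL OF `G′(U)` ON THE CLASS (3.35)**: for sites `x, y`, a fibre value `E`, and any `ρ` with the two Lipschitz properties, `ρ(y) = 0` and `ρ(x) ≥ r`: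
`HS((G′(U)(δ_y ⊗ E))(x)) ≤ 256·(L^{lev x})²(L^{lev y})²·(e^{δ₀r})⁻²·HS(E)`, `δ₀ = 1∕(4(d+2))` — the entries of `G′(U; x, y)` are `≤ 16·L^{lev x}L^{lev y}e^{−δ₀ρ_y(x)}`
in Hilbert–Schmidt operator norm on the fibre, print's (3.42)₁ for ONE-SITE sources (`B₀(Lʲη)²e^{−δ₀d}`), member-∕volume-∕k-∕N-∕U-uniformly.
[cite: Balaban1985BackgroundPropagators, Thm 3.1 (3.42) p.397, (3.46) p.398; Agmon1982, Ch.1, Thm 1.5] -/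
theorem hs_GpY_deltaY_le_exp_canonical [Nonempty (Fin N)] (hG : G ≤ B7Prop2Explicit.unitaryUnits (Matrix (Fin N) (Fin N) ℂ))
    {U : CfgY (Matrix (Fin N) (Fin N) ℂ) i} {c α₀ : ℝ} (hC0 : 0 ≤ c * (kGeo i).M * α₀) (hC1 : c * (kGeo i).M * α₀ * ((d : ℝ) + 1) ≤ 1 / 16)
    (hreg : (bg9K (Matrix (Fin N) (Fin N) ℂ) G i).Reg335 c α₀ U) {ρ : SiteY i → ℝ}
    (hρ1 : ∀ μ z, |ρ (shiftY i μ z) - ρ z| ≤ ((((ℓ + 1) ^ (blkOf i.D.toDomains z).1.1 : ℕ) : ℝ))⁻¹)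
    (hρ2 : ∀ μ z, |ρ (shiftY i μ z) - ρ z| ≤ ((((ℓ + 1) ^ (blkOf i.D.toDomains (shiftY i μ z)).1.1 : ℕ) : ℝ))⁻¹)
    (hρD : ∀ z w : SiteY i, blkOf i.D.toDomains w = blkOf i.D.toDomains z → |ρ z - ρ w| ≤ (d : ℝ) + 1)
    (x y : SiteY i) (hρy : ρ y = 0) {r : ℝ} (hr : r ≤ ρ x) (E : Matrix (Fin N) (Fin N) ℂ) :
    ∑ a, ∑ b, ‖GpY i (parSymY i) U (deltaY y E) x a b‖ ^ 2
      ≤ 256 * (((((ℓ + 1) ^ (blkOf i.D.toDomains x).1.1 : ℕ) : ℝ)) ^ 2 * ((((ℓ + 1) ^ (blkOf i.D.toDomains y).1.1 : ℕ) : ℝ)) ^ 2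
          / Real.exp ((1 / (4 * ((d : ℝ) + 2))) * r) ^ 2) * ∑ a, ∑ b, ‖E a b‖ ^ 2 := by
  classical
  have hΨ : ∀ z, z ∉ ({y} : Finset (SiteY i)) → deltaY y E z = 0 := fun z hz => by
    rw [Finset.mem_singleton] at hz
    simp [deltaY, hz]
  have h := hs_restrict_GpY_parSymY_le_exp_canonical i hG hC0 hC1 hreg hρ1 hρ2 hρD (A := {x}) (B := {y}) hΨ
    (fun z hz => by rw [Finset.mem_singleton.1 hz]; exact hρy) (jA := (blkOf i.D.toDomains x).1.1) (jB := (blkOf i.D.toDomains y).1.1)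
    (fun z hz => by rw [Finset.mem_singleton.1 hz]) (fun z hz => by rw [Finset.mem_singleton.1 hz]) (r := r)
    (fun z hz => by rw [Finset.mem_singleton.1 hz]; exact hr)
  rw [Finset.sum_singleton] at h
  have hE : trIP (fun _ => (1 : ℝ)) (deltaY y E) (deltaY y E) = ∑ a, ∑ b, ‖E a b‖ ^ 2 := by
    rw [trIP_deltaY_left, one_mul, hs_eq_re_trace]
    simp [deltaY]
  rw [hE] at h
  exact h

end Literature.MathematicalPhysics.QuantumFieldTheory.Balaban1983to89.B9Thm31SiteGpWeightedReg335Y
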